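/-
Copyright (c) 2026 the pub-hodgecm-mathlib formalisation cell (harness21).  Prover seat hodgecm-mathlib-LH4-p16 (g0), req620 Track A «(D-RAM) FOUR-FRAME» squad
(STAGE-1b, row (2) of the piece `f_{T₊}`, the (β₂) road under heir LEAD F0P3a-plan (g21) T20-18∕T20-19 (R-36); row (L-K) holder; β₂-board sub-dealer LH4-p04 (g8)
BETA2-BOARD v1.1 §0 labels `q± = shell ∧ letter`), 2026-09-04.
-/
import Summits.HodgeConjecture.HodgeConjecture.Theorems.F0P3cDyRamBlockGlueLabelFibreConstant  -- ★ p861015 (LH4-p04 (g8)): brings ★ (E1) `forall_endoGL_sub_one[_sq]_mulVec_mem_scaleLattice_iff_plane`, ★ `latticeInLevel_iff_forall`, ★ census DEFS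
import Summits.HodgeConjecture.HodgeConjecture.Theorems.F0P3cDyRamToricCensusDefs            -- ★ DEFS leaf (LH4-p12 (g4)): `IsOrd`, `dualGen`
import HarnessLib

/-!
# Crux `H413`, line LH4 «(D-RAM) FOUR-FRAME» — STAGE-1b, row (2), the (β₂) road (R-36): «THE SHELL IN THE LINE MODEL» — the level tokens `LatticeInLevel ϖ ℓ (Γ − 1) L`,
# `LatticeInLevel ϖ m ((Γ − 1)²) L` and the near-transvection shell of a glued vertex over `Λ = x₀·𝒪_j`, read as ORDER MEMBERSHIPS of `(lam − 1)∕ϖE^ℓ` and of the DEPTH QUOTIENT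
# `κ_Λ∕ϖE^ℓ`, `κ_Λ = (lam − jE u₀₀)∕Y`

Cell `hodgecm-mathlib` (D-0151), FLOOR 0, crux item H413 = `stmt-HodgeConjecture-24833`, route of record `HCCMUnconditional`; squad F0∕P3c∕LH4; lane
`--supports stmt-HodgeConjecture-24833 --as helper` (count-neutral; pays NO tier-0 row).  THEOREMS ONLY (no `def`, no instance, no notation, no `sorry`, default heartbeats);
★-only imports; states NO law.  DATUM-FREE: plane `(E², ·)` with `|ϖ| = exp(−1)`, block element `Γ = endoGL (γ₂, u)`, a glued vertex `L` with tube coordinate `b` (★ (E1) letters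
`hb hpr hB hg₀ hg₀1 hprg`), and ★ (C1)'s line model `(M, jE, ρ, α; φ, lam)` (`hφs hφi hφγ`) presenting `Λ = φ(B₂) = x₀·𝒪_j` with `φ w₀ = Y⁻¹x₀`.

WHY (BETA2-BOARD v1.1 §0; MECH-K0 v1 67ac68e4 §0).  The board's labels are `q± = SHELL ∧ LETTER`: the letter half is in M-letters since ★ p861311∕p861372∕p861454 (depth form ∕
norm form ∕ depth scalar); THIS FILE puts the SHELL half in the same letters.  ★ (E1) HEADLINE 1∕2 (`UnitaryLatticeTreeBlockGlueLevel`) read the levels of `Γ − 1` and `(Γ − 1)²` on a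
glued vertex in plane letters — `|u₀₀ − 1| ≤ |c| ∧ c⁻¹(γ₂ − 1)B₂ ⊆ B₂ ∧ c⁻¹(γ₂ − u₀₀)w₀ ∈ B₂` (resp. squares); pushing through `φ` (`φ(γ₂y) = lam·φy`, `φ(B₂) = x₀·𝒪_j`,
`φ w₀ = Y⁻¹x₀`) the two lattice clauses become memberships in the order `𝒪_j = {IsOrd ρ α (ϖE^j) ·}`:
* §1 order helpers (`isOrd_one`, `isOrd_mul`) and the transport `forall_smul_mulVec_mem_iff_isOrd` (`c⁻¹(γ₂ − 1)B₂ ⊆ B₂ ⟺ IsOrd ((lam − 1)∕jE c)`) ∕ `smul_sub_mem_iff_isOrd`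
  (`c⁻¹(γ₂ − u₀₀)w₀ ∈ B₂ ⟺ IsOrd ((lam − jE u₀₀)∕(jE c·Y))`).
* §2 HEADS `latticeInLevel_endoGL_sub_one_iff_isOrd` — `LatticeInLevel ϖ ℓ (Γ − 1) L ⟺ |u₀₀ − 1| ≤ |ϖ^ℓ| ∧ IsOrd ((lam − 1)∕ϖE^ℓ) ∧ IsOrd (κ_Λ∕ϖE^ℓ)`, `κ_Λ = (lam − jE u₀₀)∕Y`
  (the third clause is the one that bites near 1: the SHELL `ℓ₀` of a cone vertex is the exact ϖE-adic position of its depth quotient in `𝒪_j` — MECH-K0 §0), and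
  `latticeInLevel_endoGL_sub_one_sq_iff_isOrd` — `LatticeInLevel ϖ m ((Γ − 1)²) L ⟺ |(u₀₀ − 1)²| ≤ |ϖ^m| ∧ IsOrd ((lam − 1)²∕ϖE^m) ∧ IsOrd (((lam − 1)² − (jE u₀₀ − 1)²)∕(ϖE^m·Y))`;
  `latticeNearTransvShell_endoGL_sub_one_iff_isOrd` — the shell token of the census as the conjunction.
HONEST LABEL.  Count-neutral lattice ∕ order algebra; nothing printed is asserted; `HC_CM` is proved only modulo the 7 printed citations (2 remaining named inputs: hLiu418 =
`stmt-HodgeConjecture-24832`, h413 = `stmt-HodgeConjecture-24833`) until rung 0 closes.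
## References
* [Kottwitz1986BaseChangeUnits] R. E. Kottwitz, *Base change for unit elements of Hecke algebras*, Compositio Math. 60 (1986): §1 pp. 240–241, §3 (congruence levels on lattices).
* [Jacobowitz1962] R. Jacobowitz, *Hermitian forms over local fields*, Amer. J. Math. 84 (1962): §4.
* [Serre1979] J.-P. Serre, *Local Fields*, GTM 67 (1979): Ch. III §6 Prop. 12 (orders of conductor `c`).
* [Rogawski1990] J. D. Rogawski, *Automorphic Representations of Unitary Groups in Three Variables*, Ann. of Math. Stud. 123 (1990): §4.9–§4.10 pp. 55–60.
-/

set_option autoImplicit false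

noncomputable section

namespace Summit.HodgeConjecture.HodgeConjecture.Cruxes.H413.F0P3cDyRamShellLineModel

open scoped Valued WithZero Matrix MatrixGroups
open WithZero
open Literature.NumberTheory.Automorphic Literature.NumberTheory.Automorphic.HermitianLattice Literature.NumberTheory.Automorphic.UnitaryLatticeTree
open Literature.NumberTheory.Rogawski1990
open Summit.HodgeConjecture.HodgeConjecture.Cruxes.H413.F0P3cDyRamToricCensusDefs
open Summit.HodgeConjecture.HodgeConjecture.Cruxes.H413.F0P3cDyRamFourFrameCensusDefs (LatticeInLevel LatticeNearTransvShell)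
open Summit.HodgeConjecture.HodgeConjecture.Cruxes.H413.F0P3cDyRamProfileCountCentralRescaling (latticeInLevel_iff_forall)

variable {E M : Type*} [Field E] [Valued E ℤᵐ⁰] [Field M] [Valued M ℤᵐ⁰] {ρ : M →+* M} {α : M}

/-! ## §1 Order helpers and the `φ`-transport of the two plane clauses -/

/-- `1` lies in every order. [cite: Serre1979, Ch. III §6 Prop. 12] -/
theorem isOrd_one (cc : M) : IsOrd ρ α cc 1 := by
  rw [isOrd_iff, map_one, map_one, sub_self, map_zero]
  exact ⟨le_rfl, zero_le⟩

/-- Orders are closed under multiplication (`ρ` isometric): `tz − ρ(tz) = t(z − ρz) + (t − ρt)·ρz`. [cite: Serre1979, Ch. III §6 Prop. 12] -/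
theorem isOrd_mul (hvρ : ∀ x, Valued.v (ρ x) = Valued.v x) {cc t z : M} (ht : IsOrd ρ α cc t) (hz : IsOrd ρ α cc z) : IsOrd ρ α cc (t * z) := by
  rw [isOrd_iff] at ht hz ⊢
  refine ⟨by rw [map_mul]; exact mul_le_one' ht.1 hz.1, ?_⟩
  have e : t * z - ρ (t * z) = t * (z - ρ z) + (t - ρ t) * ρ z := by rw [map_mul]; ring
  rw [e]
  refine (Valuation.map_add _ _ _).trans (max_le ?_ ?_)
  · rw [map_mul]; exact (mul_le_of_le_one_left' ht.1).trans hz.2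
  · rw [map_mul, hvρ]; exact (mul_le_of_le_one_right' hz.1).trans ht.2

/-- `t` multiplies the order into itself iff `t` lies in the order. [cite: Serre1979, Ch. III §6 Prop. 12] -/
theorem forall_isOrd_mul_iff (hvρ : ∀ x, Valued.v (ρ x) = Valued.v x) (cc t : M) : (∀ z, IsOrd ρ α cc z → IsOrd ρ α cc (t * z)) ↔ IsOrd ρ α cc t :=
  ⟨fun h => by simpa using h 1 (isOrd_one cc), fun ht _ hz => isOrd_mul hvρ ht hz⟩

omit [Valued M ℤᵐ⁰] in
/-- Membership transport through the line model: `v ∈ B₂ ↔ φ v ∈ Λ` (`φ` injective, `φ(B₂) = Λ`). [cite: Jacobowitz1962, §4] -/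
theorem mem_iff_map_mem (φ : (Fin 2 → E) →+ M) (hφi : Function.Injective φ) {B₂ : Submodule 𝒪[E] (Fin 2 → E)} {Λ : AddSubgroup M}
    (hBΛ : B₂.toAddSubgroup.map φ = Λ) (v : Fin 2 → E) : v ∈ B₂ ↔ φ v ∈ Λ := by
  rw [← hBΛ, AddSubgroup.mem_map]
  constructor
  · exact fun hv => ⟨v, hv, rfl⟩
  · rintro ⟨w, hw, hwv⟩
    rwa [← hφi hwv]

omit [Valued E ℤᵐ⁰] [Valued M ℤᵐ⁰] in
/-- `φ(c⁻¹ • ((γ₂ − 1)y)) = (jE c)⁻¹·(lam − 1)·φ y`. [cite: Jacobowitz1962, §4] -/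
theorem map_smul_sub_one_mulVec (jE : E →+* M) (φ : (Fin 2 → E) →+ M) (hφs : ∀ (c : E) (x : Fin 2 → E), φ (c • x) = jE c * φ x)
    {γ₂ : GL (Fin 2) E} {lam : M} (hφγ : ∀ x, φ ((γ₂ : Matrix (Fin 2) (Fin 2) E) *ᵥ x) = lam * φ x) (c : E) (y : Fin 2 → E) :
    φ (c⁻¹ • (((γ₂ : Matrix (Fin 2) (Fin 2) E) - 1) *ᵥ y)) = (jE c)⁻¹ * ((lam - 1) * φ y) := by
  rw [hφs, map_inv₀, Matrix.sub_mulVec, Matrix.one_mulVec, map_sub, hφγ, sub_one_mul]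

omit [Valued E ℤᵐ⁰] [Valued M ℤᵐ⁰] in
/-- `φ(c⁻¹ • (γ₂w₀ − u₀₀w₀)) = (jE c)⁻¹·(lam − jE u₀₀)·φ w₀`. [cite: Jacobowitz1962, §4] -/
theorem map_smul_mulVec_sub_smul (jE : E →+* M) (φ : (Fin 2 → E) →+ M) (hφs : ∀ (c : E) (x : Fin 2 → E), φ (c • x) = jE c * φ x)
    {γ₂ : GL (Fin 2) E} {lam : M} (hφγ : ∀ x, φ ((γ₂ : Matrix (Fin 2) (Fin 2) E) *ᵥ x) = lam * φ x) (c u₀ : E) (w₀ : Fin 2 → E) :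
    φ (c⁻¹ • ((γ₂ : Matrix (Fin 2) (Fin 2) E) *ᵥ w₀ - u₀ • w₀)) = (jE c)⁻¹ * ((lam - jE u₀) * φ w₀) := by
  rw [hφs, map_inv₀, map_sub, hφγ, hφs, sub_mul]

/-- **`c⁻¹(γ₂ − 1)·B₂ ⊆ B₂ ⟺ IsOrd ((lam − 1)∕jE c)`** for `φ(B₂) = Λ = x₀·𝒪_j` (`x₀ ≠ 0`, `ρ` isometric). [cite: Serre1979, Ch. III §6 Prop. 12] [cite: Kottwitz1986BaseChangeUnits, §3] -/
theorem forall_smul_mulVec_mem_iff_isOrd (hvρ : ∀ x, Valued.v (ρ x) = Valued.v x) (jE : E →+* M) (φ : (Fin 2 → E) →+ M)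
    (hφs : ∀ (c : E) (x : Fin 2 → E), φ (c • x) = jE c * φ x) (hφi : Function.Injective φ)
    {γ₂ : GL (Fin 2) E} {lam : M} (hφγ : ∀ x, φ ((γ₂ : Matrix (Fin 2) (Fin 2) E) *ᵥ x) = lam * φ x)
    {B₂ : Submodule 𝒪[E] (Fin 2 → E)} {Λ : AddSubgroup M} (hBΛ : B₂.toAddSubgroup.map φ = Λ) {cc x₀ : M} (hx₀ : x₀ ≠ 0)
    (hΛx : ∀ x, x ∈ Λ ↔ ∃ z, IsOrd ρ α cc z ∧ x = x₀ * z) {c : E} (hc : c ≠ 0) :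
    (∀ y ∈ B₂, c⁻¹ • ((((γ₂ : Matrix (Fin 2) (Fin 2) E) - 1)) *ᵥ y) ∈ B₂) ↔ IsOrd ρ α cc ((lam - 1) / jE c) := by
  have hjc : jE c ≠ 0 := (map_ne_zero jE).2 hc
  rw [← forall_isOrd_mul_iff hvρ cc]
  constructor
  · intro h z hz
    have hy : x₀ * z ∈ Λ := (hΛx _).2 ⟨z, hz, rfl⟩
    rw [← hBΛ, AddSubgroup.mem_map] at hy
    obtain ⟨y, hyB, hyz⟩ := hy
    have h1 := (mem_iff_map_mem φ hφi hBΛ _).1 (h y hyB)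
    rw [map_smul_sub_one_mulVec jE φ hφs hφγ, show φ y = x₀ * z from hyz] at h1
    obtain ⟨z', hz', hzz'⟩ := (hΛx _).1 h1
    have : (lam - 1) / jE c * z = z' := by
      have e : (jE c)⁻¹ * ((lam - 1) * (x₀ * z)) = x₀ * ((lam - 1) / jE c * z) := by rw [div_eq_mul_inv]; ring
      rw [e] at hzz'
      exact mul_left_cancel₀ hx₀ hzz'
    rwa [this]
  · intro h y hyB
    rw [mem_iff_map_mem φ hφi hBΛ, map_smul_sub_one_mulVec jE φ hφs hφγ]
    obtain ⟨z, hz, hyz⟩ := (hΛx _).1 ((mem_iff_map_mem φ hφi hBΛ y).1 hyB)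
    rw [hyz]
    exact (hΛx _).2 ⟨(lam - 1) / jE c * z, h z hz, by rw [div_eq_mul_inv]; ring⟩

/-- **`c⁻¹(γ₂w₀ − u₀₀w₀) ∈ B₂ ⟺ IsOrd ((lam − jE u₀₀)∕(jE c·Y))`** for `φ(B₂) = Λ = x₀·𝒪_j`, `φ w₀ = Y⁻¹x₀` (`x₀, Y ≠ 0`). [cite: Serre1979, Ch. III §6 Prop. 12] [cite: Kottwitz1986BaseChangeUnits, §3] -/
theorem smul_sub_mem_iff_isOrd (jE : E →+* M) (φ : (Fin 2 → E) →+ M) (hφs : ∀ (c : E) (x : Fin 2 → E), φ (c • x) = jE c * φ x) (hφi : Function.Injective φ)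
    {γ₂ : GL (Fin 2) E} {lam : M} (hφγ : ∀ x, φ ((γ₂ : Matrix (Fin 2) (Fin 2) E) *ᵥ x) = lam * φ x)
    {B₂ : Submodule 𝒪[E] (Fin 2 → E)} {Λ : AddSubgroup M} (hBΛ : B₂.toAddSubgroup.map φ = Λ) {cc x₀ Y : M} (hx₀ : x₀ ≠ 0) (hY : Y ≠ 0)
    (hΛx : ∀ x, x ∈ Λ ↔ ∃ z, IsOrd ρ α cc z ∧ x = x₀ * z) {w₀ : Fin 2 → E} (hw₀Y : φ w₀ = Y⁻¹ * x₀) {c : E} (hc : c ≠ 0) (u₀ : E) :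
    c⁻¹ • ((γ₂ : Matrix (Fin 2) (Fin 2) E) *ᵥ w₀ - u₀ • w₀) ∈ B₂ ↔ IsOrd ρ α cc ((lam - jE u₀) / (jE c * Y)) := by
  have hjc : jE c ≠ 0 := (map_ne_zero jE).2 hc
  rw [mem_iff_map_mem φ hφi hBΛ, map_smul_mulVec_sub_smul jE φ hφs hφγ, hw₀Y, hΛx]
  have e : (jE c)⁻¹ * ((lam - jE u₀) * (Y⁻¹ * x₀)) = x₀ * ((lam - jE u₀) / (jE c * Y)) := by field_simp
  rw [e]
  constructor
  · rintro ⟨z, hz, hzz⟩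
    rwa [mul_left_cancel₀ hx₀ hzz]
  · exact fun h => ⟨_, h, rfl⟩

/-! ## §2 HEADS — the level tokens and the shell of a glued vertex, in the line model -/

/-- **HEAD — `LatticeInLevel ϖ ℓ (Γ − 1) L ⟺ |u₀₀ − 1| ≤ |ϖ^ℓ| ∧ IsOrd ((lam − 1)∕ϖE^ℓ) ∧ IsOrd ((lam − jE u₀₀)∕(ϖE^ℓ·Y))`** (`ϖE = jE ϖ`) for a glued vertex `L` with tube `b`
over the plane data `(B₂, w₀, g₀)` (★ (E1) letters) presented in the line model by `Λ = φ(B₂) = x₀·𝒪_j`, `φ w₀ = Y⁻¹x₀` (★ (E1) HEADLINE 1 through `φ`).  The third clause — the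
position of the DEPTH QUOTIENT `κ_Λ = (lam − jE u₀₀)∕Y` in `𝒪_j` — is the one that decides the shell near `1`. [cite: Kottwitz1986BaseChangeUnits, §3] [cite: Serre1979, Ch. III §6 Prop. 12] -/
theorem latticeInLevel_endoGL_sub_one_iff_isOrd (hvρ : ∀ x, Valued.v (ρ x) = Valued.v x) {ϖ : E} (hϖ : Valued.v ϖ = exp (-1 : ℤ))
    (jE : E →+* M) (φ : (Fin 2 → E) →+ M) (hφs : ∀ (c : E) (x : Fin 2 → E), φ (c • x) = jE c * φ x) (hφi : Function.Injective φ)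
    {γ₂ : GL (Fin 2) E} {lam : M} (hφγ : ∀ x, φ ((γ₂ : Matrix (Fin 2) (Fin 2) E) *ᵥ x) = lam * φ x)
    {L : Submodule 𝒪[E] (Fin 3 → E)} {b : ℕ} (hb : ∀ a : E, (Pi.single 1 a : Fin 3 → E) ∈ L ↔ Valued.v a ≤ Valued.v ϖ ^ b)
    (hpr : ∀ x ∈ L, Valued.v (x 1) * Valued.v ϖ ^ b ≤ 1)
    {B₂ : Submodule 𝒪[E] (Fin 2 → E)} {w₀ : Fin 2 → E} {g₀ : Fin 3 → E}
    (hB : B₂.map ((Matrix.toLin' (!![1, 0; 0, 0; 0, 1] : Matrix (Fin 3) (Fin 2) E)).restrictScalars 𝒪[E]) =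
      L ⊓ LinearMap.ker ((LinearMap.proj (1 : Fin 3) : (Fin 3 → E) →ₗ[E] E).restrictScalars 𝒪[E]))
    (hg₀ : g₀ ∈ L) (hg₀1 : Valued.v (g₀ 1) * Valued.v ϖ ^ b = 1) (hprg : g₀ - Pi.single 1 (g₀ 1) = ![w₀ 0, 0, w₀ 1])
    {Λ : AddSubgroup M} (hBΛ : B₂.toAddSubgroup.map φ = Λ) {cc x₀ Y : M} (hx₀ : x₀ ≠ 0) (hY : Y ≠ 0)
    (hΛx : ∀ x, x ∈ Λ ↔ ∃ z, IsOrd ρ α cc z ∧ x = x₀ * z) (hw₀Y : φ w₀ = Y⁻¹ * x₀) (u : GL (Fin 1) E) (ℓ : ℕ) :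
    LatticeInLevel ϖ ℓ ((((endoGL (γ₂, u) : GL (Fin 3) E) : Matrix (Fin 3) (Fin 3) E) - 1)) L ↔
      Valued.v ((u : Matrix (Fin 1) (Fin 1) E) 0 0 - 1) ≤ Valued.v (ϖ ^ ℓ) ∧ IsOrd ρ α cc ((lam - 1) / jE ϖ ^ ℓ) ∧
        IsOrd ρ α cc ((lam - jE ((u : Matrix (Fin 1) (Fin 1) E) 0 0)) / (jE ϖ ^ ℓ * Y)) := by
  have hvϖ0 : Valued.v ϖ ≠ 0 := by rw [hϖ]; exact exp_ne_zero
  have hϖ0 : ϖ ≠ 0 := fun h0 => by rw [h0, map_zero] at hvϖ0; exact hvϖ0 rfl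
  have hc : ϖ ^ ℓ ≠ 0 := pow_ne_zero ℓ hϖ0
  rw [latticeInLevel_iff_forall, forall_endoGL_sub_one_mulVec_mem_scaleLattice_iff_plane hϖ hc hb hpr hB hg₀ hg₀1 hprg γ₂ u,
    forall_smul_mulVec_mem_iff_isOrd hvρ jE φ hφs hφi hφγ hBΛ hx₀ hΛx hc, smul_sub_mem_iff_isOrd jE φ hφs hφi hφγ hBΛ hx₀ hY hΛx hw₀Y hc, map_pow jE ϖ ℓ]

/-- **HEAD — THE SQUARE LEVEL: `LatticeInLevel ϖ m ((Γ − 1)²) L ⟺ |(u₀₀ − 1)²| ≤ |ϖ^m| ∧ IsOrd ((lam − 1)²∕ϖE^m) ∧ IsOrd (((lam − 1)² − (jE u₀₀ − 1)²)∕(ϖE^m·Y))`**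
(★ (E1) HEADLINE 2 through `φ`: `(γ₂ − 1)²` acts on `Λ` by `(lam − 1)²`, and `(γ₂ − 1)²w₀ − (u₀₀ − 1)²w₀ ↦ ((lam − 1)² − (jE u₀₀ − 1)²)·Y⁻¹x₀`).
[cite: Kottwitz1986BaseChangeUnits, §3] [cite: Serre1979, Ch. III §6 Prop. 12] -/
theorem latticeInLevel_endoGL_sub_one_sq_iff_isOrd (hvρ : ∀ x, Valued.v (ρ x) = Valued.v x) {ϖ : E} (hϖ : Valued.v ϖ = exp (-1 : ℤ))
    (jE : E →+* M) (φ : (Fin 2 → E) →+ M) (hφs : ∀ (c : E) (x : Fin 2 → E), φ (c • x) = jE c * φ x) (hφi : Function.Injective φ)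
    {γ₂ : GL (Fin 2) E} {lam : M} (hφγ : ∀ x, φ ((γ₂ : Matrix (Fin 2) (Fin 2) E) *ᵥ x) = lam * φ x)
    {L : Submodule 𝒪[E] (Fin 3 → E)} {b : ℕ} (hb : ∀ a : E, (Pi.single 1 a : Fin 3 → E) ∈ L ↔ Valued.v a ≤ Valued.v ϖ ^ b)
    (hpr : ∀ x ∈ L, Valued.v (x 1) * Valued.v ϖ ^ b ≤ 1)
    {B₂ : Submodule 𝒪[E] (Fin 2 → E)} {w₀ : Fin 2 → E} {g₀ : Fin 3 → E}
    (hB : B₂.map ((Matrix.toLin' (!![1, 0; 0, 0; 0, 1] : Matrix (Fin 3) (Fin 2) E)).restrictScalars 𝒪[E]) =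
      L ⊓ LinearMap.ker ((LinearMap.proj (1 : Fin 3) : (Fin 3 → E) →ₗ[E] E).restrictScalars 𝒪[E]))
    (hg₀ : g₀ ∈ L) (hg₀1 : Valued.v (g₀ 1) * Valued.v ϖ ^ b = 1) (hprg : g₀ - Pi.single 1 (g₀ 1) = ![w₀ 0, 0, w₀ 1])
    {Λ : AddSubgroup M} (hBΛ : B₂.toAddSubgroup.map φ = Λ) {cc x₀ Y : M} (hx₀ : x₀ ≠ 0) (hY : Y ≠ 0)
    (hΛx : ∀ x, x ∈ Λ ↔ ∃ z, IsOrd ρ α cc z ∧ x = x₀ * z) (hw₀Y : φ w₀ = Y⁻¹ * x₀) (u : GL (Fin 1) E) (m : ℕ) :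
    LatticeInLevel ϖ m ((((endoGL (γ₂, u) : GL (Fin 3) E) : Matrix (Fin 3) (Fin 3) E) - 1) * ((((endoGL (γ₂, u) : GL (Fin 3) E) : Matrix (Fin 3) (Fin 3) E) - 1))) L ↔
      Valued.v (((u : Matrix (Fin 1) (Fin 1) E) 0 0 - 1) ^ 2) ≤ Valued.v (ϖ ^ m) ∧ IsOrd ρ α cc ((lam - 1) ^ 2 / jE ϖ ^ m) ∧
        IsOrd ρ α cc (((lam - 1) ^ 2 - (jE ((u : Matrix (Fin 1) (Fin 1) E) 0 0) - 1) ^ 2) / (jE ϖ ^ m * Y)) := by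
  have hvϖ0 : Valued.v ϖ ≠ 0 := by rw [hϖ]; exact exp_ne_zero
  have hϖ0 : ϖ ≠ 0 := fun h0 => by rw [h0, map_zero] at hvϖ0; exact hvϖ0 rfl
  have hc : ϖ ^ m ≠ 0 := pow_ne_zero m hϖ0
  have hjc : jE (ϖ ^ m) ≠ 0 := (map_ne_zero jE).2 hc
  -- `φ` transports `(γ₂ − 1)²` to multiplication by `(lam − 1)²`
  have hφγ2 : ∀ x, φ (((((γ₂ : Matrix (Fin 2) (Fin 2) E) - 1) * ((γ₂ : Matrix (Fin 2) (Fin 2) E) - 1))) *ᵥ x) = (lam - 1) ^ 2 * φ x := fun x => by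
    rw [← Matrix.mulVec_mulVec, Matrix.sub_mulVec, Matrix.one_mulVec, map_sub, hφγ, Matrix.sub_mulVec, Matrix.one_mulVec, map_sub, hφγ]
    ring
  -- the second clause: same argument as `forall_smul_mulVec_mem_iff_isOrd` with `lam ↦ (lam − 1)² + 1`
  have h2 : (∀ y ∈ B₂, (ϖ ^ m)⁻¹ • (((((γ₂ : Matrix (Fin 2) (Fin 2) E) - 1) * ((γ₂ : Matrix (Fin 2) (Fin 2) E) - 1))) *ᵥ y) ∈ B₂) ↔
      IsOrd ρ α cc ((lam - 1) ^ 2 / jE (ϖ ^ m)) := by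
    rw [← forall_isOrd_mul_iff hvρ cc]
    constructor
    · intro h z hz
      have hy : x₀ * z ∈ Λ := (hΛx _).2 ⟨z, hz, rfl⟩
      rw [← hBΛ, AddSubgroup.mem_map] at hy
      obtain ⟨y, hyB, hyz⟩ := hy
      have h1 := (mem_iff_map_mem φ hφi hBΛ _).1 (h y hyB)
      rw [hφs, map_inv₀, hφγ2, show φ y = x₀ * z from hyz] at h1
      obtain ⟨z', hz', hzz'⟩ := (hΛx _).1 h1
      have : (lam - 1) ^ 2 / jE (ϖ ^ m) * z = z' := by
        have e : (jE (ϖ ^ m))⁻¹ * ((lam - 1) ^ 2 * (x₀ * z)) = x₀ * ((lam - 1) ^ 2 / jE (ϖ ^ m) * z) := by rw [div_eq_mul_inv]; ring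
        rw [e] at hzz'
        exact mul_left_cancel₀ hx₀ hzz'
      rwa [this]
    · intro h y hyB
      rw [mem_iff_map_mem φ hφi hBΛ, hφs, map_inv₀, hφγ2]
      obtain ⟨z, hz, hyz⟩ := (hΛx _).1 ((mem_iff_map_mem φ hφi hBΛ y).1 hyB)
      rw [hyz]
      exact (hΛx _).2 ⟨(lam - 1) ^ 2 / jE (ϖ ^ m) * z, h z hz, by rw [div_eq_mul_inv]; ring⟩
  -- the third clause
  have h3 : (ϖ ^ m)⁻¹ • ((((((γ₂ : Matrix (Fin 2) (Fin 2) E) - 1) * ((γ₂ : Matrix (Fin 2) (Fin 2) E) - 1))) *ᵥ w₀) -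
        (((u : Matrix (Fin 1) (Fin 1) E) 0 0 - 1) ^ 2) • w₀) ∈ B₂ ↔
      IsOrd ρ α cc (((lam - 1) ^ 2 - (jE ((u : Matrix (Fin 1) (Fin 1) E) 0 0) - 1) ^ 2) / (jE (ϖ ^ m) * Y)) := by
    rw [mem_iff_map_mem φ hφi hBΛ, hφs, map_inv₀, map_sub φ, hφγ2, hφs, hw₀Y, map_pow jE ((u : Matrix (Fin 1) (Fin 1) E) 0 0 - 1) 2, map_sub jE, map_one, hΛx]
    have e : (jE (ϖ ^ m))⁻¹ * ((lam - 1) ^ 2 * (Y⁻¹ * x₀) - (jE ((u : Matrix (Fin 1) (Fin 1) E) 0 0) - 1) ^ 2 * (Y⁻¹ * x₀)) =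
        x₀ * (((lam - 1) ^ 2 - (jE ((u : Matrix (Fin 1) (Fin 1) E) 0 0) - 1) ^ 2) / (jE (ϖ ^ m) * Y)) := by field_simp
    rw [e]
    constructor
    · rintro ⟨z, hz, hzz⟩
      rwa [mul_left_cancel₀ hx₀ hzz]
    · exact fun h => ⟨_, h, rfl⟩
  rw [latticeInLevel_iff_forall, forall_endoGL_sub_one_sq_mulVec_mem_scaleLattice_iff_plane hϖ hc hb hpr hB hg₀ hg₀1 hprg γ₂ u, h2, h3, map_pow jE ϖ m]

/-- **HEAD — THE NEAR-TRANSVECTION SHELL IN THE LINE MODEL**: ★ census DEFS `LatticeNearTransvShell ϖ ℓ m (Γ − 1) L` (`= InLevel ℓ ∧ ¬InLevel (ℓ+1) ∧ InLevel m ((Γ−1)²)`) as the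
conjunction of the two HEADS above. [cite: Kottwitz1986BaseChangeUnits, §3] [cite: Rogawski1990, §4.9–§4.10 pp. 55–60] -/
theorem latticeNearTransvShell_endoGL_sub_one_iff_isOrd (hvρ : ∀ x, Valued.v (ρ x) = Valued.v x) {ϖ : E} (hϖ : Valued.v ϖ = exp (-1 : ℤ))
    (jE : E →+* M) (φ : (Fin 2 → E) →+ M) (hφs : ∀ (c : E) (x : Fin 2 → E), φ (c • x) = jE c * φ x) (hφi : Function.Injective φ)
    {γ₂ : GL (Fin 2) E} {lam : M} (hφγ : ∀ x, φ ((γ₂ : Matrix (Fin 2) (Fin 2) E) *ᵥ x) = lam * φ x)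
    {L : Submodule 𝒪[E] (Fin 3 → E)} {b : ℕ} (hb : ∀ a : E, (Pi.single 1 a : Fin 3 → E) ∈ L ↔ Valued.v a ≤ Valued.v ϖ ^ b)
    (hpr : ∀ x ∈ L, Valued.v (x 1) * Valued.v ϖ ^ b ≤ 1)
    {B₂ : Submodule 𝒪[E] (Fin 2 → E)} {w₀ : Fin 2 → E} {g₀ : Fin 3 → E}
    (hB : B₂.map ((Matrix.toLin' (!![1, 0; 0, 0; 0, 1] : Matrix (Fin 3) (Fin 2) E)).restrictScalars 𝒪[E]) =
      L ⊓ LinearMap.ker ((LinearMap.proj (1 : Fin 3) : (Fin 3 → E) →ₗ[E] E).restrictScalars 𝒪[E]))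
    (hg₀ : g₀ ∈ L) (hg₀1 : Valued.v (g₀ 1) * Valued.v ϖ ^ b = 1) (hprg : g₀ - Pi.single 1 (g₀ 1) = ![w₀ 0, 0, w₀ 1])
    {Λ : AddSubgroup M} (hBΛ : B₂.toAddSubgroup.map φ = Λ) {cc x₀ Y : M} (hx₀ : x₀ ≠ 0) (hY : Y ≠ 0)
    (hΛx : ∀ x, x ∈ Λ ↔ ∃ z, IsOrd ρ α cc z ∧ x = x₀ * z) (hw₀Y : φ w₀ = Y⁻¹ * x₀) (u : GL (Fin 1) E) (ℓ m : ℕ) :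
    LatticeNearTransvShell ϖ ℓ m ((((endoGL (γ₂, u) : GL (Fin 3) E) : Matrix (Fin 3) (Fin 3) E) - 1)) L ↔
      (Valued.v ((u : Matrix (Fin 1) (Fin 1) E) 0 0 - 1) ≤ Valued.v (ϖ ^ ℓ) ∧ IsOrd ρ α cc ((lam - 1) / jE ϖ ^ ℓ) ∧
          IsOrd ρ α cc ((lam - jE ((u : Matrix (Fin 1) (Fin 1) E) 0 0)) / (jE ϖ ^ ℓ * Y))) ∧
        ¬ (Valued.v ((u : Matrix (Fin 1) (Fin 1) E) 0 0 - 1) ≤ Valued.v (ϖ ^ (ℓ + 1)) ∧ IsOrd ρ α cc ((lam - 1) / jE ϖ ^ (ℓ + 1)) ∧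
            IsOrd ρ α cc ((lam - jE ((u : Matrix (Fin 1) (Fin 1) E) 0 0)) / (jE ϖ ^ (ℓ + 1) * Y))) ∧
        (Valued.v (((u : Matrix (Fin 1) (Fin 1) E) 0 0 - 1) ^ 2) ≤ Valued.v (ϖ ^ m) ∧ IsOrd ρ α cc ((lam - 1) ^ 2 / jE ϖ ^ m) ∧
          IsOrd ρ α cc (((lam - 1) ^ 2 - (jE ((u : Matrix (Fin 1) (Fin 1) E) 0 0) - 1) ^ 2) / (jE ϖ ^ m * Y))) := by
  unfold Summit.HodgeConjecture.HodgeConjecture.Cruxes.H413.F0P3cDyRamFourFrameCensusDefs.LatticeNearTransvShell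
  rw [latticeInLevel_endoGL_sub_one_iff_isOrd hvρ hϖ jE φ hφs hφi hφγ hb hpr hB hg₀ hg₀1 hprg hBΛ hx₀ hY hΛx hw₀Y u ℓ,
    latticeInLevel_endoGL_sub_one_iff_isOrd hvρ hϖ jE φ hφs hφi hφγ hb hpr hB hg₀ hg₀1 hprg hBΛ hx₀ hY hΛx hw₀Y u (ℓ + 1),
    latticeInLevel_endoGL_sub_one_sq_iff_isOrd hvρ hϖ jE φ hφs hφi hφγ hb hpr hB hg₀ hg₀1 hprg hBΛ hx₀ hY hΛx hw₀Y u m]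

end Summit.HodgeConjecture.HodgeConjecture.Cruxes.H413.F0P3cDyRamShellLineModel

end
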